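import Summits.QuantumFields.YangMills.Theorems.BalabanUVNodesN15KingModelTranslationCovariance
import Summits.QuantumFields.YangMills.Theorems.BalabanUVNodesN15KingModelGraphTreeDecayExtensive

/-!
# BalabanUVNodes ∕ N15 — THE KING-MODEL RUNG (PART Ϙ-b): TRANSLATION COVARIANCE OF THE RUNG's OBJECTS — THE LINE KERNELS `G^η_K`∕`∂^η_μG^η_K`, THE LEGS
# `ℋ_K`∕`∂^η_μℋ_K` (coarse and fine spellings), KING's PAIRING `x′ ↦ x`, THE BLOCK INDICATORS `χ_b`, AND THE RUNG's THREE NE2 KERNELS (`G^η_{(K)}` at base points,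
# `(Δ^{(K)})⁻¹`, their η-differences) — ALL INVARIANT UNDER `x ↦ x + L^K·v`, `b ↦ b + v`
# (Track A, DAG node N15 = NE2; FAN-OUT v1.1 §N15 s3 «KING-MODEL RUNG … NE2's analogue DECIDED in the model»)

HONEST FRAMING.  Count-neutral (cell `pub-ymgap`, seat `pub-ymgap-dag-n15-e` g31; `--supports stmt-QuantumFields-27366 --as helper` = K3⁸
`SpineGivenEndpointR13SepCoPHV`).  TEMPLATE LITERATURE: C. King, *The U(1) Higgs model. I. The continuum limit*, Commun. Math. Phys. **102** (1986) 649–677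
[King1986] — KING's OWN `A = 0` MODEL on the rung's tori `T_η = Tor (fine (L^K) (kingVol L jv))` over `T^{(K)} = Tor (kingVol L jv)`.  NOT Bałaban's `G(U)`; NOT a
node discharge (N15 is booked through n15-a's knit, untouched here); nothing continuum ∕ ℝ⁴ ∕ OS ∕ mass-gap ∕ Clay.  0 `sorry`; standard axioms.  Sequel of part Ϙ-a
(`…TranslationCovariance`: `constrainedProp_transl`, `minimiser_single_transl`, `topPiece_transl`, `effLaplacian_inv_transl`, `blockOf_add_up`, `torCongr_add_up`).

THE PRINT.  p. 663: *«Every internal line in H carries a propagator G_k … or one of their derivatives»*; Prop. 3.8 (3.71) p. 664 (the external lines `a_kG_kQ_k^*(x, y)`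
and their pairing *«When x′ ∈ T_{η′}, we denote by x that point in T_η for which x′ ∈ B^n(x)»*); (3.36) p. 660 (the partition of unity `χ_z`); p. 659 *«E₁ is
represented by a sum of vacuum energy diagrams»*.  On the torus at `A = 0` all these objects are block-translation covariant; King never says so because it is
obvious in momentum space ((4.1)–(4.5) p. 670).  This file records it for the rung's position-space objects, by name.

WHAT THIS FILE PROVES (kernel; 0 `def`).  §1 ★★ `kingGLine_transl` (both kinds: `G^η_K(x + N·v, y + N·v) = G^η_K(x, y)`, `∂^η_μG^η_K` likewise), `val_up`,
★ `kingSlicePt_add_up` (King's pairing commutes with block translations: `(x′ + L^{K+n}·v)↓ = x′↓ + L^K·v`), `blockIndLo_transl`∕`blockIndHi_transl`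
(`χ_{b+v}(x + N·v) = χ_b(x)` on both lattices).  §2 ★★ `kingH_transl`∕`dkingH_transl` (`ℋ_K(x + N·v, b + v) = ℋ_K(x, b)` and its gradient), ★★ `kingExtLo_transl`,
★★ `kingExtHi_transl` (the fine legs, through `torCongr` along `L^{K+n} = L^n·L^K`).  §3 `basePt_add_up`, ★ `topPieceBase_transl`∕`topPieceStep_transl`,
★ `blockCov_transl`∕`blockCovStep_transl` — the rung's g0 NE2 kernels (`G^η_{(K)}` at base points, `(Δ^{(K)})⁻¹`, and their two-spacing differences) are
TRANSLATION INVARIANT on `T^{(K)}` (functions of `b − b′` only) — the structural property King's toy model has and Bałaban's `G(U)` replaces by covariance in `U`.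

HONEST SCOPE.  Torus ∕ periodic b.c. and `A = 0` only (part Ϙ-a, HONEST SCOPE); nothing here is an estimate; the graph-level consumers (EXACT extensivity of vacuum
diagrams; translation invariance of the continuum kernels) are parts Ϙ-c∕Ϙ-d.  N15 untouched; counts unmoved.
Locators: [King1986] (2.10)–(2.15) pp.652–653, (2.17) p.653, (3.36) p.660, p.663, Prop. 3.8 (3.71) p.664, (4.1)–(4.5) p.670, (4.44) p.675.
-/

noncomputable section

open scoped BigOperators
open Finset Matrix

namespace Summit.QuantumFields.YangMills.BalabanUVNodes.N15KingModelRung.Curved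

open Literature.MathematicalPhysics.QuantumFieldTheory.Balaban1983to89.B5Prop11Plancherel (Tor fine unitVec)
open Literature.MathematicalPhysics.QuantumFieldTheory.Balaban1983to89 (B5Block118.up B5Block118.up_add)
open Literature.MathematicalPhysics.QuantumFieldTheory.King1986 (aK)
open Literature.MathematicalPhysics.QuantumFieldTheory.King1986.Torus
open Summit.QuantumFields.YangMills.BalabanUVNodes.N15KingModelRung
open Summit.QuantumFields.YangMills.BalabanUVNodes.N15KingModelRung.Transl

variable {d : ℕ} (L : ℕ) [NeZero L]

/-! ## §1 Line kernels, King's pairing and the block indicators -/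

section Lines

/-- ★★ **THE RUNG's LINE KERNELS ARE INVARIANT UNDER BLOCK TRANSLATIONS** — both kinds: `G^η_K(x + N·v, y + N·v) = G^η_K(x, y)` and
`∂^η_μG^η_K(x + N·v, y + N·v) = ∂^η_μG^η_K(x, y)` (`N = L^K`). [cite: King1986, (2.13) p.653, p.663 («Every internal line … carries a propagator G_k … or one of their derivatives»)] -/
theorem kingGLine_transl (M : Fin (d + 1) → ℕ) [∀ μ, NeZero (M μ)] (a msq : ℝ) (k : ℕ) (κ : Option (Fin (d + 1)))
    (x y : Tor (fine (L ^ k) M)) (v : Tor M) :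
    kingGLine L M a msq k κ (x + B5Block118.up (L ^ k) M v) (y + B5Block118.up (L ^ k) M v) = kingGLine L M a msq k κ x y := by
  cases κ with
  | none => exact constrainedProp_transl (L ^ k) M _ _ _ x y v
  | some μ =>
      show (L : ℝ) ^ k * (constrainedProp (L ^ k) M (aK a L k) (((L ^ k : ℕ) : ℝ) ^ 2) msq (x + B5Block118.up (L ^ k) M v + unitVec (fine (L ^ k) M) μ)
            (y + B5Block118.up (L ^ k) M v) - constrainedProp (L ^ k) M (aK a L k) (((L ^ k : ℕ) : ℝ) ^ 2) msq (x + B5Block118.up (L ^ k) M v)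
            (y + B5Block118.up (L ^ k) M v))
        = (L : ℝ) ^ k * (constrainedProp (L ^ k) M (aK a L k) (((L ^ k : ℕ) : ℝ) ^ 2) msq (x + unitVec (fine (L ^ k) M) μ) y
            - constrainedProp (L ^ k) M (aK a L k) (((L ^ k : ℕ) : ℝ) ^ 2) msq x y)
      rw [add_right_comm, constrainedProp_transl, constrainedProp_transl]

/-- The coordinates of the lift: `(N·v)_μ = N·v_μ` (no wrap-around). [cite: King1986, (2.10) p.653] -/
theorem val_up (N : ℕ) [NeZero N] (M : Fin (d + 1) → ℕ) [∀ μ, NeZero (M μ)] (v : Tor M) (μ : Fin (d + 1)) :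
    (B5Block118.up N M v μ).val = N * (v μ).val := by
  rw [← corner_eq_up]
  show (((N * (v μ).val : ℕ) : ZMod (fine N M μ))).val = N * (v μ).val
  rw [ZMod.val_natCast, Nat.mod_eq_of_lt]
  show N * (v μ).val < N * M μ
  have h1 : (v μ).val < M μ := ZMod.val_lt _
  have h2 : 0 < N := Nat.pos_of_ne_zero (NeZero.ne N)
  nlinarith

omit [NeZero L] in
/-- The integer bookkeeping of the pairing under a block translation: `⌊((A + P·B) mod (P·C))∕Q⌋ = (⌊A∕Q⌋ + R·B) mod (R·C)` for `P = Q·R`, `Q > 0`. [folklore] -/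
theorem pairing_transl_nat {A B C P Q R : ℕ} (hQ : 0 < Q) (hP : P = Q * R) :
    (A + P * B) % (P * C) / Q = (A / Q + R * B) % (R * C) := by
  subst hP
  rw [show Q * R * B = Q * (R * B) by ring, show Q * R * C = Q * (R * C) by ring, Nat.mod_mul_right_div_self,
    Nat.add_mul_div_left _ _ hQ]

/-- ★ **KING's PAIRING COMMUTES WITH BLOCK TRANSLATIONS**: the point under `x′ + L^{K+n}·v` is `(x′)↓ + L^K·v`. [cite: King1986, p.664 («x′ ∈ B^n(x)»), (2.10) p.653] -/
theorem kingSlicePt_add_up (k n : ℕ) (M : Fin (d + 1) → ℕ) [∀ μ, NeZero (M μ)] (x' : Tor (fine (L ^ (k + n)) M)) (v : Tor M) :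
    kingSlicePt L k n M (x' + B5Block118.up (L ^ (k + n)) M v) = kingSlicePt L k n M x' + B5Block118.up (L ^ k) M v := by
  have hLn : 0 < L ^ n := pow_pos (Nat.pos_of_ne_zero (NeZero.ne L)) n
  have hP : L ^ (k + n) = L ^ n * L ^ k := by rw [pow_add, mul_comm]
  funext μ
  apply ZMod.val_injective
  rw [val_kingSlicePt, Pi.add_apply, Pi.add_apply, ZMod.val_add, ZMod.val_add, val_kingSlicePt, val_up, val_up]
  exact pairing_transl_nat hLn hP

/-- `χ_{b+v}(x + N·v) = χ_b(x)` on `T_η`. [cite: King1986, (3.36) p.660] -/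
theorem blockIndLo_transl (jv : KingVolIndex d) (b₀ v : Tor (kingVol L jv))
    (x : haveI := kingVol_neZero L jv; Tor (fine (L ^ jv.K) (kingVol L jv))) :
    haveI := kingVol_neZero L jv
    blockIndLo L jv (b₀ + v) (x + B5Block118.up (L ^ jv.K) (kingVol L jv) v) = blockIndLo L jv b₀ x := by
  haveI := kingVol_neZero L jv
  simp only [blockIndLo, blockOf_add_up, add_left_inj]

/-- `χ_{b+v}(x′ + L^{K+n}·v) = χ_b(x′)` on `T_{η′}` (the indicator read through the pairing). [cite: King1986, (3.36) p.660, p.664 (pairing)] -/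
theorem blockIndHi_transl (jv : KingVolIndex d) (n : ℕ) (b₀ v : Tor (kingVol L jv))
    (x' : haveI := kingVol_neZero L jv; Tor (fine (L ^ (jv.K + n)) (kingVol L jv))) :
    haveI := kingVol_neZero L jv
    blockIndHi L jv n (b₀ + v) (x' + B5Block118.up (L ^ (jv.K + n)) (kingVol L jv) v) = blockIndHi L jv n b₀ x' := by
  haveI := kingVol_neZero L jv
  unfold blockIndHi
  rw [kingSlicePt_add_up, blockIndLo_transl]

end Lines

/-! ## §2 The legs: King's minimiser kernels, coarse and fine spellings -/

section Legs

omit [NeZero L] in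
/-- ★★ **`ℋ_K(x + N·v, b + v) = ℋ_K(x, b)`.** [cite: King1986, (2.15) p.653, Prop. 3.8 (3.71) p.664] -/
theorem kingH_transl (Nf : ℕ) [NeZero Nf] (M : Fin (d + 1) → ℕ) [∀ μ, NeZero (M μ)] (a m2 : ℝ) (k : ℕ) (b v : Tor M) (x : Tor (fine Nf M)) :
    kingH L Nf M a m2 k (b + v) (x + B5Block118.up Nf M v) = kingH L Nf M a m2 k b x :=
  minimiser_single_transl Nf M _ _ _ x b v

omit [NeZero L] in
/-- ★★ **`∂^η_μℋ_K(x + N·v, b + v) = ∂^η_μℋ_K(x, b)`.** [cite: King1986, Prop. 3.8 (3.71) p.664 (second line)] -/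
theorem dkingH_transl (Nf : ℕ) [NeZero Nf] (M : Fin (d + 1) → ℕ) [∀ μ, NeZero (M μ)] (a m2 : ℝ) (k : ℕ) (b v : Tor M) (μ : Fin (d + 1))
    (x : Tor (fine Nf M)) :
    dkingH L Nf M a m2 k (b + v) μ (x + B5Block118.up Nf M v) = dkingH L Nf M a m2 k b μ x := by
  unfold dkingH
  rw [add_right_comm, kingH_transl, kingH_transl]

/-- ★★ **THE COARSE LEGS ARE COVARIANT**: `kingExtLo (b + v) κ (x + N·v) = kingExtLo b κ x` (both kinds). [cite: King1986, Prop. 3.8 (3.71) p.664] -/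
theorem kingExtLo_transl (a msq : ℝ) (j : KingVolIndex d) (b v : Tor (kingVol L j)) (κ : Option (Fin (d + 1)))
    (x : haveI := kingVol_neZero L j; Tor (fine (L ^ j.K) (kingVol L j))) :
    haveI := kingVol_neZero L j
    kingExtLo L a msq j (b + v) κ (x + B5Block118.up (L ^ j.K) (kingVol L j) v) = kingExtLo L a msq j b κ x := by
  haveI := kingVol_neZero L j
  cases κ with
  | none => exact kingH_transl L (L ^ j.K) (kingVol L j) a msq j.K b v x
  | some μ => exact dkingH_transl L (L ^ j.K) (kingVol L j) a msq j.K b v μ x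

/-- ★★ **THE FINE LEGS ARE COVARIANT**: `kingExtHi n (b + v) κ (x′ + L^{K+n}·v) = kingExtHi n b κ x′` (both kinds; the spelling `L^{K+n} = L^n·L^K` is crossed by
`torCongr_add_up`). [cite: King1986, Prop. 3.8 (3.71) p.664] -/
theorem kingExtHi_transl (a msq : ℝ) (j : KingVolIndex d) (n : ℕ) (b v : Tor (kingVol L j)) (κ : Option (Fin (d + 1)))
    (x' : haveI := kingVol_neZero L j; Tor (fine (L ^ (j.K + n)) (kingVol L j))) :
    haveI := kingVol_neZero L j
    kingExtHi L a msq j n (b + v) κ (x' + B5Block118.up (L ^ (j.K + n)) (kingVol L j) v) = kingExtHi L a msq j n b κ x' := by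
  haveI := kingVol_neZero L j
  haveI : NeZero (L ^ n * L ^ j.K) := ⟨mul_ne_zero (pow_ne_zero _ (NeZero.ne L)) (pow_ne_zero _ (NeZero.ne L))⟩
  have hN : L ^ (j.K + n) = L ^ n * L ^ j.K := by rw [pow_add, mul_comm]
  cases κ with
  | none =>
      show kingH L (L ^ n * L ^ j.K) (kingVol L j) a msq (j.K + n) (b + v)
            (torCongr (carrier_pow_add L j.K n (kingVol L j)) (x' + B5Block118.up (L ^ (j.K + n)) (kingVol L j) v))
          = kingH L (L ^ n * L ^ j.K) (kingVol L j) a msq (j.K + n) b (torCongr (carrier_pow_add L j.K n (kingVol L j)) x')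
      rw [torCongr_add_up _ _ _ hN, kingH_transl]
  | some μ =>
      show dkingH L (L ^ n * L ^ j.K) (kingVol L j) a msq (j.K + n) (b + v) μ
            (torCongr (carrier_pow_add L j.K n (kingVol L j)) (x' + B5Block118.up (L ^ (j.K + n)) (kingVol L j) v))
          = dkingH L (L ^ n * L ^ j.K) (kingVol L j) a msq (j.K + n) b μ (torCongr (carrier_pow_add L j.K n (kingVol L j)) x')
      rw [torCongr_add_up _ _ _ hN, dkingH_transl]

end Legs

/-! ## §3 The rung's NE2 kernels: `G^η_{(K)}` at base points, `(Δ^{(K)})⁻¹`, and their η-differences — translation invariant on `T^{(K)}` -/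

section NE2Kernels

/-- `N·(b + v) = N·b + N·v` for the base points. [cite: King1986, p.664 (pairing convention)] -/
theorem basePt_add_up (Nf : ℕ) [NeZero Nf] (M : Fin (d + 1) → ℕ) [∀ μ, NeZero (M μ)] (b v : Tor M) :
    basePt Nf M (b + v) = basePt Nf M b + B5Block118.up Nf M v := by
  unfold basePt
  rw [site_add_up]

omit [NeZero L] in
/-- ★ **`G^η_{(K)}(N·(b + v), N·(b′ + v)) = G^η_{(K)}(N·b, N·b′)`** — the rung's site-layer kernel is translation invariant. [cite: King1986, (2.17) p.653, (4.44) p.675] -/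
theorem topPieceBase_transl (Nf : ℕ) [NeZero Nf] (M : Fin (d + 1) → ℕ) [∀ μ, NeZero (M μ)] (a m2 : ℝ) (K : ℕ) (b b' v : Tor M) :
    topPieceBase L Nf M a m2 K (b + v) (b' + v) = topPieceBase L Nf M a m2 K b b' := by
  unfold topPieceBase
  rw [basePt_add_up, basePt_add_up, topPiece_transl]

/-- ★ **… and so is its η-difference** `G^{η′}_{(K+1)} − G^η_{(K)}` at base points (the rung's NE2 SITE kernel `topPieceSite`). [cite: King1986, Prop. 3.9 (3.73) p.665, p.675] -/
theorem topPieceStep_transl (a m2 : ℝ) (j : KingVolIndex d) (b b' v : Tor (kingVol L j)) :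
    topPieceStep L a m2 j (b + v) (b' + v) = topPieceStep L a m2 j b b' := by
  haveI := kingVol_neZero L j
  haveI : NeZero (L ^ 1 * L ^ j.K) := ⟨mul_ne_zero (pow_ne_zero _ (NeZero.ne L)) (pow_ne_zero _ (NeZero.ne L))⟩
  unfold topPieceStep
  rw [topPieceBase_transl, topPieceBase_transl]

omit [NeZero L] in
/-- ★ **`(Δ^{(K)})⁻¹(b + v, b′ + v) = (Δ^{(K)})⁻¹(b, b′)`** — the block covariance is translation invariant. [cite: King1986, (2.14) p.653, (4.5) p.670, (4.41) p.675] -/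
theorem blockCov_transl (Nf : ℕ) [NeZero Nf] (M : Fin (d + 1) → ℕ) [∀ μ, NeZero (M μ)] (a m2 : ℝ) (K : ℕ) (b b' v : Tor M) :
    blockCov L Nf M a m2 K (b + v) (b' + v) = blockCov L Nf M a m2 K b b' :=
  effLaplacian_inv_transl Nf M _ _ _ b b' v

/-- ★ **… and so is its η-difference** `(Δ^{(K+1)})⁻¹ − (Δ^{(K)})⁻¹` (the rung's NE2 UNIT kernel `blockCovUnit`). [cite: King1986, (4.39)–(4.41) pp.674–675] -/
theorem blockCovStep_transl (a m2 : ℝ) (j : KingVolIndex d) (b b' v : Tor (kingVol L j)) :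
    blockCovStep L a m2 j (b + v) (b' + v) = blockCovStep L a m2 j b b' := by
  haveI := kingVol_neZero L j
  haveI : NeZero (L ^ 1 * L ^ j.K) := ⟨mul_ne_zero (pow_ne_zero _ (NeZero.ne L)) (pow_ne_zero _ (NeZero.ne L))⟩
  unfold blockCovStep
  rw [blockCov_transl, blockCov_transl]

end NE2Kernels

end Summit.QuantumFields.YangMills.BalabanUVNodes.N15KingModelRung.Curved

end
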